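import Summits.NavierStokesRegularity.FluidComputer.PalasekTowerStageTightness

/-!
# REGISTER v2.3′: the GLOBAL SPEED MAXIMUM `t ↦ sup_x ‖u(t, x)‖` of a finite-energy classical Clay flow is
# ATTAINED at every time and CONTINUOUS on the slab

Cell `ns-blowup`, seat `ns-blowup-fc-prover-3` (g3; prover; D-0074 GROUP C/E «BRIDGE SUPPORT»;
bears_on LADDER-NS N1, route `PalasekTowerBreakdown`, cruxes stmt-NavierStokesRegularity-19249 / -19250
(the hand-over statements are statements about this function) — supports only, nothing claimed). The
hygiene lemma behind this seat's first-hitting / line-crossing files (g2 p441519, p441906; g3 p446722,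
p446972, p446973, p447684), which argue on level sets without naming the maximum function. LABEL: E–C
typing (KERNEL analysis; every statement PROVED; no `Prop` or definition introduced). WHAT THIS IS NOT:
not Navier–Stokes evidence — a regularity fact about EVERY finite-energy classical Clay flow; nothing is
constructed; no stub is decided.

## What is proved

* `exists_norm_eq_iSup_of_clay` — for a finite-energy classical solution on `[0, T]` with Schwartz datum
  and Clay force (`ν > 0`), at every `t ∈ [0, T]` the supremum `⨆ x, ‖u(t, x)‖` is a MAXIMUM (Tao class ⇒
  bounded speed; uniform decay `LocalEnergy.exists_radius_norm_lt` ⇒ the super-level sets are in a ball;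
  compactness).
* `continuousOn_iSup_norm_of_clay` — the function `t ↦ ⨆ x, ‖u(t, x)‖` is CONTINUOUS on `[0, T]`: for every
  `L > 0` it agrees up to `L` with `t ↦ max (sup over the decay ball B̄(0, ρ_L)) L`, which is continuous by
  joint continuity on the compact box (`IsCompact.continuous_sSup`); uniform approximation.
* `Stage.exists_norm_eq_iSup`, `Stage.continuousOn_iSup_norm`, `Stage.iSup_norm_le_ceiling`,
  `Stage.floor_le_iSup_norm` — the register's forms: along every registered stage (`ν > 0`) the global
  speed maximum is a continuous function on `[0, τ_k]`, `≤ c₂ Y_j` on `[0, τ_j]` and `≥ c₁ Y_j` at `τ_j`;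
  hence (`Stage.exists_iSup_norm_eq_of_mem_Icc`) it takes EVERY value between `c₂ Y_j` and `c₁ Y_{j+1}`
  inside the window `[τ_j, τ_{j+1}]` (intermediate value theorem) — the continuous-path reading of the
  hand-over that the first-hitting theorems sample at first instants.

References: T. Tao, Anal. PDE 6 (2013), Cor. 11.1 (Tao class) [cite: Tao2011, Cor. 11.1]; S. Palasek,
arXiv:2605.13827 §4 [cite: Palasek2026ElementaryModel, §4].
-/

noncomputable section

namespace Summit.NavierStokesRegularity.FluidComputer.PalasekTowerClayBridge

open Set MeasureTheory Filter Topology Function Real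
open scoped ENNReal ContDiff NNReal
open Literature.Analysis.FluidPDE

/-! ## §1 Any finite-energy classical Clay flow -/

section Clay

variable {ν T : ℝ} {f u : ℝ → EuclideanSpace ℝ (Fin 3) → EuclideanSpace ℝ (Fin 3)}
  {p : ℝ → EuclideanSpace ℝ (Fin 3) → ℝ}

/-- Tao's class gives a uniform speed bound and, for every positive level, a uniform decay radius.
[cite: Tao2011, Cor. 11.1] -/
theorem exists_bound_and_radius_of_clay (hν : 0 < ν) (hT : 0 < T)
    (h : IsClassicalNSSolutionOn (Icc 0 T) ν f u p) (h₀ : HasRapidSpatialDecay (u 0))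
    (hfs : IsSmoothOnHalfSpace f) (hfd : HasRapidSpaceTimeDecay f)
    (hE : ∃ C : ℝ≥0∞, C < ⊤ ∧ ∀ t ∈ Icc 0 T, ∫⁻ x, ‖u t x‖ₑ ^ 2 ≤ C) :
    (∃ M : ℝ, ∀ t ∈ Icc 0 T, ∀ x, ‖u t x‖ ≤ M) ∧
      ∀ L : ℝ, 0 < L → ∃ ρ : ℝ, ∀ t ∈ Icc 0 T, ∀ x : EuclideanSpace ℝ (Fin 3),
        ρ ≤ ‖x‖ → ‖u t x‖ < L := by
  obtain ⟨C, hCt, hC⟩ := hE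
  have hE' : ∃ C : ℝ≥0, ∀ t ∈ Icc 0 T, ∫⁻ x, ‖u t x‖ₑ ^ 2 ≤ C :=
    ⟨C.toNNReal, fun t ht => (hC t ht).trans (ENNReal.coe_toNNReal hCt.ne).ge⟩
  have hTao : HasBoundedSobolevNormsOn (Icc 0 T) u :=
    h.hasBoundedSobolevNormsOn_of_clayForce hν hT hE' h₀ hfs hfd
  have hsm : ∀ t ∈ Icc 0 T, ContDiff ℝ ∞ (u t) := fun t ht => h.contDiff_velocity ht
  obtain ⟨M, -, hM⟩ := hTao.exists_forall_norm_iteratedFDeriv_le hsm 0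
  obtain ⟨B, -, hB⟩ := hTao.exists_forall_norm_iteratedFDeriv_le hsm 1
  have hM' : ∀ t ∈ Icc 0 T, ∀ x, ‖u t x‖ ≤ M := fun t ht x => by simpa using hM t ht x
  have hB' : ∀ t ∈ Icc 0 T, ∀ x, ‖fderiv ℝ (u t) x‖ ≤ B := fun t ht x => by
    have h1 := hB t ht x
    rwa [← norm_iteratedFDeriv_fderiv (n := 0), norm_iteratedFDeriv_zero] at h1
  exact ⟨⟨M, hM'⟩, fun L hL => LocalEnergy.exists_radius_norm_lt hν hT h hfs hfd hM' hB' hE' hL⟩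

/-- **The speed supremum is a maximum at every time** (finite-energy classical Clay flow, `ν > 0`).
[cite: Tao2011, Cor. 11.1] -/
theorem exists_norm_eq_iSup_of_clay (hν : 0 < ν) (hT : 0 < T)
    (h : IsClassicalNSSolutionOn (Icc 0 T) ν f u p) (h₀ : HasRapidSpatialDecay (u 0))
    (hfs : IsSmoothOnHalfSpace f) (hfd : HasRapidSpaceTimeDecay f)
    (hE : ∃ C : ℝ≥0∞, C < ⊤ ∧ ∀ t ∈ Icc 0 T, ∫⁻ x, ‖u t x‖ₑ ^ 2 ≤ C) {t : ℝ} (ht : t ∈ Icc 0 T) :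
    ∃ x₀ : EuclideanSpace ℝ (Fin 3), (∀ x, ‖u t x‖ ≤ ‖u t x₀‖) ∧ ‖u t x₀‖ = ⨆ x, ‖u t x‖ := by
  obtain ⟨⟨M, hM⟩, hdec⟩ := exists_bound_and_radius_of_clay hν hT h h₀ hfs hfd hE
  have hbdd : BddAbove (range fun x => ‖u t x‖) := ⟨M, by rintro _ ⟨x, rfl⟩; exact hM t ht x⟩
  -- either the slice vanishes identically, or some speed is positive and the maximum sits in a ball
  by_cases hzero : ∀ x, ‖u t x‖ = 0
  · refine ⟨0, fun x => by rw [hzero x, hzero 0], le_antisymm (le_ciSup hbdd 0) ?_⟩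
    exact ciSup_le fun x => by rw [hzero x, hzero 0]
  · push Not at hzero
    obtain ⟨x₁, hx₁⟩ := hzero
    have hL : 0 < ‖u t x₁‖ := lt_of_le_of_ne (norm_nonneg _) (Ne.symm hx₁)
    obtain ⟨ρ, hρ⟩ := hdec _ hL
    -- maximum of the continuous slice on the compact ball
    have hcont : ContinuousOn (fun x => ‖u t x‖) (Metric.closedBall 0 ρ) :=
      ((h.contDiff_velocity ht).continuous.norm).continuousOn
    have hx₁ball : x₁ ∈ Metric.closedBall (0 : EuclideanSpace ℝ (Fin 3)) ρ := by
      rw [Metric.mem_closedBall, dist_zero_right]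
      by_contra hlt
      exact absurd (hρ t ht x₁ (le_of_not_ge hlt)) (lt_irrefl _)
    obtain ⟨x₀, -, hx₀⟩ :=
      (isCompact_closedBall (0 : EuclideanSpace ℝ (Fin 3)) ρ).exists_isMaxOn ⟨x₁, hx₁ball⟩ hcont
    have hmax : ∀ x, ‖u t x‖ ≤ ‖u t x₀‖ := by
      intro x
      by_cases hx : x ∈ Metric.closedBall (0 : EuclideanSpace ℝ (Fin 3)) ρ
      · exact hx₀ hx
      · rw [Metric.mem_closedBall, dist_zero_right, not_le] at hx
        exact ((hρ t ht x hx.le).trans_le (hx₀ hx₁ball)).le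
    exact ⟨x₀, hmax, le_antisymm (le_ciSup hbdd x₀) (ciSup_le hmax)⟩

/-- **The global speed maximum is continuous on the slab** (finite-energy classical Clay flow, `ν > 0`):
`t ↦ ⨆ x, ‖u(t, x)‖` is continuous on `[0, T]`. [cite: Tao2011, Cor. 11.1] -/
theorem continuousOn_iSup_norm_of_clay (hν : 0 < ν) (hT : 0 < T)
    (h : IsClassicalNSSolutionOn (Icc 0 T) ν f u p) (h₀ : HasRapidSpatialDecay (u 0))
    (hfs : IsSmoothOnHalfSpace f) (hfd : HasRapidSpaceTimeDecay f)
    (hE : ∃ C : ℝ≥0∞, C < ⊤ ∧ ∀ t ∈ Icc 0 T, ∫⁻ x, ‖u t x‖ₑ ^ 2 ≤ C) :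
    ContinuousOn (fun t => ⨆ x, ‖u t x‖) (Icc 0 T) := by
  obtain ⟨⟨M, hM⟩, hdec⟩ := exists_bound_and_radius_of_clay hν hT h h₀ hfs hfd hE
  have hbdd : ∀ t ∈ Icc 0 T, BddAbove (range fun x => ‖u t x‖) := fun t ht =>
    ⟨M, by rintro _ ⟨x, rfl⟩; exact hM t ht x⟩
  -- the ball maxima are continuous in time, for every radius
  have hball : ∀ ρ : ℝ, ContinuousOn
      (fun t => sSup ((fun x => ‖u t x‖) '' Metric.closedBall (0 : EuclideanSpace ℝ (Fin 3)) ρ))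
      (Icc 0 T) := by
    intro ρ
    have hK : IsCompact (Metric.closedBall (0 : EuclideanSpace ℝ (Fin 3)) ρ) := isCompact_closedBall _ _
    -- joint continuity restricted to the subtype `Icc 0 T`
    set F : Icc (0 : ℝ) T → EuclideanSpace ℝ (Fin 3) → ℝ := fun t x => ‖u t.1 x‖ with hFdef
    have hFc : Continuous ↿F := by
      have hc : ContinuousOn (fun z : ℝ × EuclideanSpace ℝ (Fin 3) => ‖uncurry u z‖)
          (Icc (0 : ℝ) T ×ˢ univ) := h.smooth_velocity.continuousOn.norm
      have hmap : Continuous fun z : Icc (0 : ℝ) T × EuclideanSpace ℝ (Fin 3) =>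
          ((z.1 : ℝ), z.2) := (continuous_subtype_val.comp continuous_fst).prodMk continuous_snd
      have := hc.comp_continuous hmap fun z => mk_mem_prod z.1.2 (mem_univ _)
      simpa [hFdef, Function.HasUncurry.uncurry, Function.comp_def, uncurry] using this
    have hcs : Continuous fun t : Icc (0 : ℝ) T =>
        sSup (F t '' Metric.closedBall (0 : EuclideanSpace ℝ (Fin 3)) ρ) := hK.continuous_sSup hFc
    rw [continuousOn_iff_continuous_restrict]
    exact hcs
  -- uniform approximation: `|⨆ - max (ball sup) L| ≤ L` for the decay radius of `L`
  rw [Metric.continuousOn_iff]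
  intro t₀ ht₀ ε hε
  obtain ⟨ρ₀, hρ₀⟩ := hdec (ε / 3) (by positivity)
  -- a nonnegative decay radius
  set ρ : ℝ := max ρ₀ 0 with hρdef
  have hρ0 : 0 ≤ ρ := le_max_right _ _
  have hρ : ∀ t ∈ Icc 0 T, ∀ x : EuclideanSpace ℝ (Fin 3), ρ ≤ ‖x‖ → ‖u t x‖ < ε / 3 :=
    fun t ht x hx => hρ₀ t ht x ((le_max_left _ _).trans hx)
  set N : ℝ → ℝ := fun t =>
    max (sSup ((fun x => ‖u t x‖) '' Metric.closedBall (0 : EuclideanSpace ℝ (Fin 3)) ρ)) (ε / 3)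
    with hNdef
  have hNc : ContinuousOn N (Icc 0 T) :=
    (continuous_id.max continuous_const).comp_continuousOn (hball ρ)
  have happrox : ∀ t ∈ Icc 0 T, |(⨆ x, ‖u t x‖) - N t| ≤ ε / 3 := by
    intro t ht
    have hbi : BddAbove ((fun x => ‖u t x‖) '' Metric.closedBall (0 : EuclideanSpace ℝ (Fin 3)) ρ) :=
      ⟨M, by rintro _ ⟨x, -, rfl⟩; exact hM t ht x⟩
    have hne : ((fun x => ‖u t x‖) '' Metric.closedBall (0 : EuclideanSpace ℝ (Fin 3)) ρ).Nonempty :=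
      ⟨_, ⟨0, by simp [hρ0], rfl⟩⟩
    -- (1) the ball supremum is below the global one
    have h1 : sSup ((fun x => ‖u t x‖) '' Metric.closedBall (0 : EuclideanSpace ℝ (Fin 3)) ρ) ≤
        ⨆ x, ‖u t x‖ :=
      csSup_le hne (by rintro _ ⟨x, -, rfl⟩; exact le_ciSup (hbdd t ht) x)
    -- (2) the global supremum is below `N t`
    have h2 : (⨆ x, ‖u t x‖) ≤ N t := by
      refine ciSup_le fun x => ?_
      by_cases hx : x ∈ Metric.closedBall (0 : EuclideanSpace ℝ (Fin 3)) ρ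
      · exact (le_csSup hbi ⟨x, hx, rfl⟩).trans (le_max_left _ _)
      · rw [Metric.mem_closedBall, dist_zero_right, not_le] at hx
        exact (hρ t ht x hx.le).le.trans (le_max_right _ _)
    -- (3) `N t ≤ ⨆ + ε/3`
    have h0 : 0 ≤ ⨆ x, ‖u t x‖ := (norm_nonneg (u t 0)).trans (le_ciSup (hbdd t ht) 0)
    have h3 : N t ≤ (⨆ x, ‖u t x‖) + ε / 3 := max_le (by linarith) (by linarith)
    rw [abs_le]; constructor <;> linarith
  obtain ⟨δ, hδ, hδN⟩ := (Metric.continuousOn_iff.1 hNc) t₀ ht₀ (ε / 3) (by positivity)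
  refine ⟨δ, hδ, fun t ht hdist => ?_⟩
  have hN := hδN t ht hdist
  rw [Real.dist_eq] at hN ⊢
  have ha := happrox t ht
  have hb := happrox t₀ ht₀
  rw [abs_le] at ha hb
  rw [abs_lt] at hN ⊢
  constructor <;> linarith [ha.1, ha.2, hb.1, hb.2, hN.1, hN.2]

end Clay

/-! ## §2 Registered stages -/

namespace Stage

variable {ν : ℝ} {R : TowerRates} {S : Schedule R} {m : Margins R} {k : ℕ}

/-- **Along every registered stage the global speed maximum is attained at every time of the slab**
(`ν > 0`; the `iSup` form of p437029's `Stage.exists_isMaxOn_norm`). [cite: Tao2011, Cor. 11.1] -/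
theorem exists_norm_eq_iSup (hν : 0 < ν) (s : Stage ν R S m k) {t : ℝ} (ht : t ∈ Icc 0 (S.τ k)) :
    ∃ x₀ : EuclideanSpace ℝ (Fin 3), (∀ x, ‖s.u t x‖ ≤ ‖s.u t x₀‖) ∧ ‖s.u t x₀‖ = ⨆ x, ‖s.u t x‖ :=
  exists_norm_eq_iSup_of_clay hν (S.τ_pos k) s.classical s.hasRapidSpatialDecay_zero S.force_smooth
    S.force_decay s.energy ht

/-- **Along every registered stage the global speed maximum `t ↦ ⨆ x, ‖u(t, x)‖` is CONTINUOUS on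
`[0, τ_k]`** (`ν > 0`; any rates, schedule, margins, level). [cite: Tao2011, Cor. 11.1] -/
theorem continuousOn_iSup_norm (hν : 0 < ν) (s : Stage ν R S m k) :
    ContinuousOn (fun t => ⨆ x, ‖s.u t x‖) (Icc 0 (S.τ k)) :=
  continuousOn_iSup_norm_of_clay hν (S.τ_pos k) s.classical s.hasRapidSpatialDecay_zero S.force_smooth
    S.force_decay s.energy

/-- The maximum function is below the ceiling `c₂ Y_j` on `[0, τ_j]` (`j ≤ k`). [folklore] -/
theorem iSup_norm_le_ceiling (s : Stage ν R S m k) {j : ℕ} (hj : j ≤ k) {t : ℝ}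
    (ht : t ∈ Icc 0 (S.τ j)) : (⨆ x, ‖s.u t x‖) ≤ S.c₂ * R.Y j :=
  ciSup_le fun x => s.ceiling j hj t ht x

/-- The maximum function is above the floor `c₁ Y_j` at `τ_j` (`j ≤ k`, `ν > 0` for boundedness).
[folklore] -/
theorem floor_le_iSup_norm (hν : 0 < ν) (s : Stage ν R S m k) {j : ℕ} (hj : j ≤ k) :
    S.c₁ * R.Y j ≤ ⨆ x, ‖s.u (S.τ j) x‖ := by
  obtain ⟨x, -, hx⟩ := s.floor j hj
  obtain ⟨M, -, hM⟩ := s.exists_norm_le hν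
  have hτ : S.τ j ∈ Icc 0 (S.τ k) := ⟨(S.τ_pos j).le, S.τ_mono hj⟩
  exact hx.trans (le_ciSup ⟨M, by rintro _ ⟨y, rfl⟩; exact hM _ hτ y⟩ x)

/-- **Every speed between the ceiling `c₂ Y_j` and the next floor `c₁ Y_{j+1}` is the exact global maximum
at some instant of the window `[τ_j, τ_{j+1}]`** (`ν > 0`, `j + 1 ≤ k`; intermediate value theorem for the
continuous maximum function). The first-hitting theorems (p441519) pick the FIRST such instant; this is the
continuous-path statement behind them. [cite: Palasek2026ElementaryModel, §4] -/
theorem exists_iSup_norm_eq_of_mem_Icc (hν : 0 < ν) (s : Stage ν R S m k) {j : ℕ} (hj : j + 1 ≤ k)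
    {L : ℝ} (hL : L ∈ Icc (S.c₂ * R.Y j) (S.c₁ * R.Y (j + 1))) :
    ∃ t ∈ Icc (S.τ j) (S.τ (j + 1)), (⨆ x, ‖s.u t x‖) = L := by
  have hτj : S.τ j ∈ Icc 0 (S.τ k) := ⟨(S.τ_pos j).le, S.τ_mono ((Nat.le_succ j).trans hj)⟩
  have hsub : Icc (S.τ j) (S.τ (j + 1)) ⊆ Icc 0 (S.τ k) :=
    fun t ht => ⟨hτj.1.trans ht.1, ht.2.trans (S.τ_mono hj)⟩
  have hcont : ContinuousOn (fun t => ⨆ x, ‖s.u t x‖) (Icc (S.τ j) (S.τ (j + 1))) :=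
    (s.continuousOn_iSup_norm hν).mono hsub
  have ha : (⨆ x, ‖s.u (S.τ j) x‖) ≤ L :=
    (s.iSup_norm_le_ceiling ((Nat.le_succ j).trans hj) ⟨(S.τ_pos j).le, le_rfl⟩).trans hL.1
  have hb : L ≤ ⨆ x, ‖s.u (S.τ (j + 1)) x‖ := hL.2.trans (s.floor_le_iSup_norm hν hj)
  have hle : S.τ j ≤ S.τ (j + 1) := (S.τ_lt_succ j).le
  obtain ⟨t, ht, htL⟩ := intermediate_value_Icc hle hcont ⟨ha, hb⟩
  exact ⟨t, ht, htL⟩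

end Stage

end Summit.NavierStokesRegularity.FluidComputer.PalasekTowerClayBridge

end
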